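import Literature.NumberTheory.Rogawski1990.ArchSingularStableTransportWallTorus    -- ★ p842577 (R1-i-c): §5 `exists_wall_archStableOrbitalIntegral_signed_eq_archDiagTorus_of_corresponds` (both sides at the wall torus point)
import Literature.NumberTheory.Rogawski1990.ArchSingularStableOrbitalEqOfRegular     -- ★ p842366 (D5): the R1 engine `prod_mul_archStableOrbitalIntegral_kottwitzSign_eq_of_regular_eq_of_clause`
import Literature.NumberTheory.Rogawski1990.ArchInnerTransferRegularOrbitIdentity    -- ★ p842954 (R1-i-d): `sum_inv_mul_integral_pi_map_conj_eq_of_isArchInnerTransfer` ((14.2.1) in Weil form ⇒ `hreg`)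
import Literature.NumberTheory.Rogawski1990.ArchSmoothCongruence                   -- ★ (T-d) FILE 4: `ArchSmooth.comp_archCongr_symm`
import Literature.NumberTheory.Rogawski1990.ArchSmoothAmbientLift                  -- ★ `ArchSmooth.exists_contDiff`
import Literature.NumberTheory.Rogawski1990.LocalTransferTransportMeasure          -- ★ `smulInvariantMeasure_transport`
import HarnessLib

/-!
# (ST-∞-s) ASSEMBLED: the signed singular archimedean stable transfer `Φ^{st,e}_{H′}(γ₀ ⊗ 1, a′; m′_s) = Φ^{st,e}_{Φ₃}(γ ⊗ 1, a; m_s)` at a non-central split-singular rational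
# class, from the (14.2.1) transfer pair in Weil form and PINNED singular members ((R1) «(L-use) at all indefinite places», END assembly; Rogawski 1990 §8.2, §14.2, Lemma 14.5.2 (b))

Topic `NumberTheory/Rogawski1990`; namespace `Literature.NumberTheory.Rogawski1990`.  THEOREMS ONLY (no `def`, no instance, no notation, no axiom, no named fact, no `sorry`).
Cell `pub/hodgecm-mathlib`, ENGINE T1 (crux H413 = `stmt-HodgeConjecture-24833`); ROAD-Sd ∕ R1 «(L-use)», brick (R1-i-END) «END ASSEMBLY» (LEAD F0P3a-plan (g10) WORD T9-8 (G); census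
`F0/P3a/F0P3a-p07/g8/CENSUS-R1i-END.F0P3a-p07g8.md` e599836f, F0P3-p03 (g10) `CENSUS-E4b-SingularPinsBuilt` 1291225b, pin (i)); author F0P3a-p07 (g9), 2026-09-01.

WHAT.  The (ST-∞-s) conjunct of the letter S1′ ★ `TamagawaSingularMembersExist` (= the (ST-∞) clause of ★ `SingularEllipticTransferCanonical`, the `PinSingularArchInnerTransfer` socket of
ENGINE T1) reads, for the REGULAR archimedean families `m′, m` of the frame (Weil form (W′)(W) for Haar measures `ν′, ν` and centraliser data `t′, t` with the compatibilities (C)(C′G) —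
★ `ArchCanonicalSingularMatrix` conjuncts 7, 8, 11, 12), SINGULAR families `m′_s` on `G′_∞ = U(H′)(L ⊗ ℝ)`, `m_s` on `G_∞ = U(Φ₃)(L ⊗ ℝ)`, every smooth (14.2.1)-pair `a′ ↦ a`
(`IsArchInnerTransfer L H′ m′ m a′ a`) and every rational `γ₀ ↔ γ` with `(γ₀ − e₁)(γ₀ − e₂) = 0`, `e₁ ≠ e₂`, `γ₀` non-central:
`Φ^{st}_{H′}(γ₀ ⊗ 1, (e∘⟦·⟧)·a′; m′_s) = Φ^{st}_{Φ₃}(γ ⊗ 1, (e∘⟦·⟧)·a; m_s)`.  **`archStableOrbitalIntegral_signed_eq_of_isArchInnerTransfer_of_pinned`** proves it from the cell's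
★ bricks under the BUILT SINGULAR PINS of the (ST-∞) witness road (W1)–(W3): after the (T-d) congruences `Ψ : U(H′) ≃ₜ* U(diag α′)`, `Φ_A : U(Φ₃) ≃ₜ* U(diag β)` and the product-Haar
readings `Ψ_* ν′ = e⁻¹_*(⊗_v ν_v)`, `(Φ_A)_* ν = e⁻¹_*(⊗_v ν′_v)` (★ p842955), the transported singular families `Ψ_* m′_s`, `(Φ_A)_* m_s` are, at EVERY wall torus point `t(z⁰∘ρ)`
(`z⁰_v 0 = z⁰_v 2 ≠ z⁰_v 1`), the Weil quotients of the product Haar measure by the transported products `⊗_v ρZ_v(ρ_v)` of per-place centraliser measures pinned as in ★ p842366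
(compact walls: inversion-invariant Haar of mass ONE; noncompact walls: transports of reference measures `ν_H v τ` whose (J-nc) constants are `−1`, pin (i) ★ p842692∕p842975) —
hypotheses `hpinα`, `hpinβ` (one `∃`-package per wall point: the binders `ρZ hρZi hρZ hM ρP hρPi hρP ρ′ hρ′i hρ′ hq` of ★ p842366 with `M v = 1`) and `νH hνH ντ hντi hντ c hcl` (★ p842366's) with `hcneg`:
`c v σ⁻¹ = −1` at the noncompact walls (such `(c, hcl)` exist by ★ p842445 §4, the pinned `νH` by ★ p842692; `ν′` Haar: a right-invariant Radon `ν′` with an admissible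
Weil quotient is non-zero, ★ `isHaarMeasure_of_isMulRightInvariant_of_ne_zero`).
PROOF.  ★ p842577 §5 puts both sides on the diagonal carriers at one wall torus point `t(z⁰)`, `z⁰_w = (σ_w a, σ_w b, σ_w a)`; ★ FILE 4 + ★ `ArchSmooth.exists_contDiff` give ambient
lifts `a′ ∘ Ψ⁻¹ = Θ ∘ coe`, `a ∘ Φ_A⁻¹ = Θ′ ∘ coe`; ★ p842954 turns (14.2.1) for the Weil-form regular families into ★ p842366's `hreg`; ★ p842366 gives
`(∏_v (−2)) · LHS = (∏_v (−2)) · RHS`; cancel.  No `IsCanonical`, no (J-val): under pin (i) all wall constants are `∓1` ((E5) of the census collapses).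
NOT HERE (the witness road, F0P3-p03 (g10)): the construction of `m′_s`, `m_s` with `hpinα`∕`hpinβ` ((W1) local conjugation-coherent pinned families, (W2) ★ p842657, (W3) global
assembly + `hq` by ★ `IsQuotientOf.atPoint_eq_quotientMeasure_of_forall_map_conj_eq`), and the other conjuncts of S1′.
HONEST LABEL: HC_CM is proved only modulo the 7 printed citations until rung 0 closes; this file is assembly of ★ cell bricks and pays nothing by itself.

## References
* [Rogawski1990] J. D. Rogawski, *Automorphic Representations of Unitary Groups in Three Variables*, Ann. of Math. Stud. 123 (1990), §1.7 p. 6, §4.1 (4.1.1)–(4.1.2) pp. 39–40, §8.2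
  Prop. 8.2.1 pp. 117–118, pp. 122–124, §14.2 (14.2.1) p. 232, §14.4 p. 237, §14.5 Lemma 14.5.2 (b) pp. 238–239.
* [Kottwitz1988] R. E. Kottwitz, *Tamagawa numbers*, Ann. of Math. 127 (1988), Prop. 2.
* [Varadarajan1989] V. S. Varadarajan, *An Introduction to Harmonic Analysis on Semisimple Lie Groups* (1989), §6.4 Thm 22.
* [BorelJacquet1979] A. Borel, H. Jacquet, *Automorphic forms and automorphic representations*, PSPM 33.1 (1979), §4.1.
* [DeitmarEchterhoff2014] A. Deitmar, S. Echterhoff, *Principles of Harmonic Analysis*, 2nd ed. (2014), Thm. 1.5.3.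
-/

set_option autoImplicit false

noncomputable section

open MeasureTheory Measure Filter Topology NumberField NumberField.InfinitePlace NumberField.mixedEmbedding Equiv Function Set
open Literature.MeasureTheory.Group Literature.NumberTheory.Automorphic
open Literature.NumberTheory.Automorphic.UnitaryGroup hiding hermForm
open Literature.AlgebraicGeometry.ShimuraVarieties (unitaryGroup hermForm)
open Literature.LinearAlgebra.Matrix
open scoped Matrix MatrixGroups Matrix.Norms.Operator ContDiff NNReal ENNReal

namespace Literature.NumberTheory.Rogawski1990

variable (L : Type) [Field L] [NumberField L] [IsCMField L] (H' : Matrix (Fin 3) (Fin 3) L) (α' β : Fin 3 → L)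
  [iGL : MeasurableSpace (GL (Fin 3) ℂ)] [iGLb : BorelSpace (GL (Fin 3) ℂ)]
  [iAH : MeasurableSpace (arch (↥(maximalRealSubfield L)) L (IsCMField.complexConj L) 3 H')] [iAHb : BorelSpace (arch (↥(maximalRealSubfield L)) L (IsCMField.complexConj L) 3 H')]
  [iAG : MeasurableSpace (arch (↥(maximalRealSubfield L)) L (IsCMField.complexConj L) 3 (Matrix.of fun i j : Fin 3 => if i.val + j.val + 1 = 3 then (1 : L) else 0))]
  [iAGb : BorelSpace (arch (↥(maximalRealSubfield L)) L (IsCMField.complexConj L) 3 (Matrix.of fun i j : Fin 3 => if i.val + j.val + 1 = 3 then (1 : L) else 0))]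
  [iQH : ∀ γ' : arch (↥(maximalRealSubfield L)) L (IsCMField.complexConj L) 3 H', MeasurableSpace (arch (↥(maximalRealSubfield L)) L (IsCMField.complexConj L) 3 H' ⧸ Subgroup.centralizer ({γ'} : Set _))]
  [iQHb : ∀ γ' : arch (↥(maximalRealSubfield L)) L (IsCMField.complexConj L) 3 H', BorelSpace (arch (↥(maximalRealSubfield L)) L (IsCMField.complexConj L) 3 H' ⧸ Subgroup.centralizer ({γ'} : Set _))]
  [iQG : ∀ γ' : arch (↥(maximalRealSubfield L)) L (IsCMField.complexConj L) 3 (Matrix.of fun i j : Fin 3 => if i.val + j.val + 1 = 3 then (1 : L) else 0),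
    MeasurableSpace (arch (↥(maximalRealSubfield L)) L (IsCMField.complexConj L) 3 (Matrix.of fun i j : Fin 3 => if i.val + j.val + 1 = 3 then (1 : L) else 0) ⧸ Subgroup.centralizer ({γ'} : Set _))]
  [iQGb : ∀ γ' : arch (↥(maximalRealSubfield L)) L (IsCMField.complexConj L) 3 (Matrix.of fun i j : Fin 3 => if i.val + j.val + 1 = 3 then (1 : L) else 0),
    BorelSpace (arch (↥(maximalRealSubfield L)) L (IsCMField.complexConj L) 3 (Matrix.of fun i j : Fin 3 => if i.val + j.val + 1 = 3 then (1 : L) else 0) ⧸ Subgroup.centralizer ({γ'} : Set _))]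
  [iAα : MeasurableSpace (arch (↥(maximalRealSubfield L)) L (IsCMField.complexConj L) 3 (Matrix.diagonal α'))] [iAαb : BorelSpace (arch (↥(maximalRealSubfield L)) L (IsCMField.complexConj L) 3 (Matrix.diagonal α'))]
  [iAβ : MeasurableSpace (arch (↥(maximalRealSubfield L)) L (IsCMField.complexConj L) 3 (Matrix.diagonal β))] [iAβb : BorelSpace (arch (↥(maximalRealSubfield L)) L (IsCMField.complexConj L) 3 (Matrix.diagonal β))]
  [iQα : ∀ γ' : arch (↥(maximalRealSubfield L)) L (IsCMField.complexConj L) 3 (Matrix.diagonal α'), MeasurableSpace (arch (↥(maximalRealSubfield L)) L (IsCMField.complexConj L) 3 (Matrix.diagonal α') ⧸ Subgroup.centralizer ({γ'} : Set _))]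
  [iQαb : ∀ γ' : arch (↥(maximalRealSubfield L)) L (IsCMField.complexConj L) 3 (Matrix.diagonal α'), BorelSpace (arch (↥(maximalRealSubfield L)) L (IsCMField.complexConj L) 3 (Matrix.diagonal α') ⧸ Subgroup.centralizer ({γ'} : Set _))]
  [iQβ : ∀ γ' : arch (↥(maximalRealSubfield L)) L (IsCMField.complexConj L) 3 (Matrix.diagonal β), MeasurableSpace (arch (↥(maximalRealSubfield L)) L (IsCMField.complexConj L) 3 (Matrix.diagonal β) ⧸ Subgroup.centralizer ({γ'} : Set _))]
  [iQβb : ∀ γ' : arch (↥(maximalRealSubfield L)) L (IsCMField.complexConj L) 3 (Matrix.diagonal β), BorelSpace (arch (↥(maximalRealSubfield L)) L (IsCMField.complexConj L) 3 (Matrix.diagonal β) ⧸ Subgroup.centralizer ({γ'} : Set _))]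
  [iLα : ∀ (v : {w : InfinitePlace L // IsComplex w}) (g : archLocal L 3 (Matrix.diagonal α') v),
    MeasurableSpace (archLocal L 3 (Matrix.diagonal α') v ⧸ Subgroup.centralizer ({g} : Set (archLocal L 3 (Matrix.diagonal α') v)))]
  [iLαb : ∀ (v : {w : InfinitePlace L // IsComplex w}) (g : archLocal L 3 (Matrix.diagonal α') v),
    BorelSpace (archLocal L 3 (Matrix.diagonal α') v ⧸ Subgroup.centralizer ({g} : Set (archLocal L 3 (Matrix.diagonal α') v)))]
  [iLβ : ∀ (v : {w : InfinitePlace L // IsComplex w}) (g : archLocal L 3 (Matrix.diagonal β) v),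
    MeasurableSpace (archLocal L 3 (Matrix.diagonal β) v ⧸ Subgroup.centralizer ({g} : Set (archLocal L 3 (Matrix.diagonal β) v)))]
  [iLβb : ∀ (v : {w : InfinitePlace L // IsComplex w}) (g : archLocal L 3 (Matrix.diagonal β) v),
    BorelSpace (archLocal L 3 (Matrix.diagonal β) v ⧸ Subgroup.centralizer ({g} : Set (archLocal L 3 (Matrix.diagonal β) v)))]

set_option maxHeartbeats 400000 in
open scoped Classical in
/-- **(R1-i-END) THE SIGNED SINGULAR arch (↥(maximalRealSubfield L)) L (IsCMField.complexConj L) 3IMEDEAN STABLE TRANSFER, ASSEMBLED** — the (ST-∞-s) conjunct of S1′ ★ `TamagawaSingularMembersExist` for singular families `m′_s`, `m_s` whose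
transports to the diagonal carriers are PINNED Weil quotients at every wall torus point (`hpinα`, `hpinβ`: ★ p842366's singular binders with `M v = 1`, one `∃`-package per wall point),
given the frame's REGULAR Weil-form data (W′)(W)(C)(C′G) VERBATIM (★ `ArchCanonicalSingularMatrix` conjuncts, `det` proofs as the binders `hd′ hd₃`), the (T-d) congruences, the
product-Haar readings of `Ψ_* ν′`, `(Φ_A)_* ν` and the pinned reference data `νH ντ c` of ★ p842366 with noncompact constants `−1`.  Then for every smooth (14.2.1)-pair `a′ ↦ a`
and every rational `γ₀ ↔ γ`, `(γ₀ − e₁)(γ₀ − e₂) = 0`, `e₁ ≠ e₂`, `γ₀` non-central: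
`Φ^{st}_{H′}(γ₀ ⊗ 1, (e∘⟦·⟧)·a′; m′_s) = Φ^{st}_{Φ₃}(γ ⊗ 1, (e∘⟦·⟧)·a; m_s)` — the trailing binders are the (ST-∞-s) `∀`-prefix token for token.  See the module docstring for the proof.
[cite: Rogawski1990, §14.5 Lemma 14.5.2 (b) pp. 238–239; §8.2 Prop. 8.2.1 pp. 117–118, pp. 122–124; §14.2 (14.2.1) p. 232; §4.1 (4.1.2) p. 39] [cite: Kottwitz1988, Prop. 2]
[cite: Varadarajan1989, §6.4 Thm 22] [cite: BorelJacquet1979, §4.1] [cite: DeitmarEchterhoff2014, Thm. 1.5.3] -/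
theorem archStableOrbitalIntegral_signed_eq_of_isArchInnerTransfer_of_pinned
    (hherm : (H'.map (cmConjRingHom L))ᵀ = H') (hanis : ∀ x : Fin 3 → L, hermForm (cmConjRingHom L) H' x x = 0 → x = 0)
    -- ===== the REGULAR archimedean data of the frame in Weil form: (W′)(W)(C)(C′G) VERBATIM =====
    (ν' : Measure (arch (↥(maximalRealSubfield L)) L (IsCMField.complexConj L) 3 H')) (ν : Measure (arch (↥(maximalRealSubfield L)) L (IsCMField.complexConj L) 3 (Matrix.of fun i j : Fin 3 => if i.val + j.val + 1 = 3 then (1 : L) else 0)))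
    [ν'.IsHaarMeasure] [ν'.IsMulRightInvariant] [ν.IsHaarMeasure] [ν.IsMulRightInvariant]
    (t' : ∀ γ' : arch (↥(maximalRealSubfield L)) L (IsCMField.complexConj L) 3 H', Measure (Subgroup.centralizer ({γ'} : Set (arch (↥(maximalRealSubfield L)) L (IsCMField.complexConj L) 3 H'))))
    (t : ∀ γ : arch (↥(maximalRealSubfield L)) L (IsCMField.complexConj L) 3 (Matrix.of fun i j : Fin 3 => if i.val + j.val + 1 = 3 then (1 : L) else 0), Measure (Subgroup.centralizer ({γ} : Set (arch (↥(maximalRealSubfield L)) L (IsCMField.complexConj L) 3 (Matrix.of fun i j : Fin 3 => if i.val + j.val + 1 = 3 then (1 : L) else 0)))))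
    (hd' : H'.det ≠ 0) (hd₃ : (Matrix.of fun i j : Fin 3 => if i.val + j.val + 1 = 3 then (1 : L) else 0).det ≠ 0)
    (hC : ∀ (γ₁ γ₂ : arch (↥(maximalRealSubfield L)) L (IsCMField.complexConj L) 3 (Matrix.of fun i j : Fin 3 => if i.val + j.val + 1 = 3 then (1 : L) else 0)) (h₁ : IsRegularElt (γ₁.val : GL (Fin 3) (mixedEmbedding.mixedSpace L)))
      (hc : Corresponds (conjMixed (↥(maximalRealSubfield L)) L (IsCMField.complexConj L)) (archFormOf L 3 (Matrix.of fun i j : Fin 3 => if i.val + j.val + 1 = 3 then (1 : L) else 0)) (archFormOf L 3 (Matrix.of fun i j : Fin 3 => if i.val + j.val + 1 = 3 then (1 : L) else 0)) γ₁ γ₂),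
      Measure.map ⇑(archStableCentralizerEquiv L hd₃ hd₃ hc h₁) (t γ₁) = t γ₂)
    (hC'G : ∀ (γ' : arch (↥(maximalRealSubfield L)) L (IsCMField.complexConj L) 3 H') (γ : arch (↥(maximalRealSubfield L)) L (IsCMField.complexConj L) 3 (Matrix.of fun i j : Fin 3 => if i.val + j.val + 1 = 3 then (1 : L) else 0)) (h' : IsRegularElt (γ'.val : GL (Fin 3) (mixedEmbedding.mixedSpace L)))
      (hc : Corresponds (conjMixed (↥(maximalRealSubfield L)) L (IsCMField.complexConj L)) (archFormOf L 3 H') (archFormOf L 3 (Matrix.of fun i j : Fin 3 => if i.val + j.val + 1 = 3 then (1 : L) else 0)) γ' γ),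
      Measure.map ⇑(archStableCentralizerEquiv L hd' hd₃ hc h') (t' γ') = t γ)
    (m' : OrbitalMeasureFamily (arch (↥(maximalRealSubfield L)) L (IsCMField.complexConj L) 3 H')) (m : OrbitalMeasureFamily (arch (↥(maximalRealSubfield L)) L (IsCMField.complexConj L) 3 (Matrix.of fun i j : Fin 3 => if i.val + j.val + 1 = 3 then (1 : L) else 0)))
    (hW' : m'.IsQuotientOf (fun γ => IsRegularElt (γ.val : GL (Fin 3) (mixedEmbedding.mixedSpace L))) ν' t')
    (hW : m.IsQuotientOf (fun γ => IsRegularElt (γ.val : GL (Fin 3) (mixedEmbedding.mixedSpace L))) ν t)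
    -- ===== the (T-d) congruences onto the diagonal carriers and the product-Haar readings of the transported measures =====
    (hα' : ∀ i, α' i ≠ 0) (hhermα : ∀ i, (IsCMField.complexConj L (α' i) : L) = α' i) (hβ : ∀ i, β i ≠ 0) (hhermβ : ∀ i, (IsCMField.complexConj L (β i) : L) = β i)
    (S : GL (Fin 3) (mixedSpace L)) (Ψ : arch (↥(maximalRealSubfield L)) L (IsCMField.complexConj L) 3 H' ≃ₜ* arch (↥(maximalRealSubfield L)) L (IsCMField.complexConj L) 3 (Matrix.diagonal α'))
    (hΨ : ∀ g, ((Ψ g : arch (↥(maximalRealSubfield L)) L (IsCMField.complexConj L) 3 (Matrix.diagonal α')) : GL (Fin 3) (mixedSpace L)) = S * (g : GL (Fin 3) (mixedSpace L)) * S⁻¹)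
    (hS : formCongr (conjMixed (↥(maximalRealSubfield L)) L (IsCMField.complexConj L)) S (archFormOf L 3 (Matrix.diagonal α')) = archFormOf L 3 H')
    (T_A : GL (Fin 3) (mixedSpace L)) (Φ_A : arch (↥(maximalRealSubfield L)) L (IsCMField.complexConj L) 3 (Matrix.of fun i j : Fin 3 => if i.val + j.val + 1 = 3 then (1 : L) else 0) ≃ₜ* arch (↥(maximalRealSubfield L)) L (IsCMField.complexConj L) 3 (Matrix.diagonal β))
    (hΦ_A : ∀ g, ((Φ_A g : arch (↥(maximalRealSubfield L)) L (IsCMField.complexConj L) 3 (Matrix.diagonal β)) : GL (Fin 3) (mixedSpace L)) = T_A * (g : GL (Fin 3) (mixedSpace L)) * T_A⁻¹)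
    (hT_A : formCongr (conjMixed (↥(maximalRealSubfield L)) L (IsCMField.complexConj L)) T_A (archFormOf L 3 (Matrix.diagonal β)) = archFormOf L 3 (Matrix.of fun i j : Fin 3 => if i.val + j.val + 1 = 3 then (1 : L) else 0))
    (νw : ∀ v : {w : InfinitePlace L // IsComplex w}, Measure (archLocal L 3 (Matrix.diagonal α') v)) (hνw : ∀ v, (νw v).IsHaarMeasure ∧ (νw v).IsMulRightInvariant)
    (hν' : ν'.map Ψ = (Measure.pi νw).map (archPiEquivCM 3 L (Matrix.diagonal α')).symm)
    (νw' : ∀ v : {w : InfinitePlace L // IsComplex w}, Measure (archLocal L 3 (Matrix.diagonal β) v)) (hνw' : ∀ v, (νw' v).IsHaarMeasure ∧ (νw' v).IsMulRightInvariant)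
    (hν : ν.map Φ_A = (Measure.pi νw').map (archPiEquivCM 3 L (Matrix.diagonal β)).symm)
    -- ===== the reference wall and the pinned reference data of ★ p842366 on both carriers (noncompact constants `−1`) =====
    (z₁ : {w : InfinitePlace L // IsComplex w} → Fin 3 → Circle) (h02 : ∀ v, z₁ v 0 = z₁ v 2) (h01 : ∀ v, z₁ v 0 ≠ z₁ v 1)
    [iRα : ∀ (v : {w : InfinitePlace L // IsComplex w}) (τ : Perm (Fin 3)), MeasurableSpace (archLocal L 3 (Matrix.diagonal (α' ∘ ⇑τ)) v ⧸ Subgroup.centralizer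
      ({(⟨circleDiagonal 3 (z₁ v), circleDiagonal_mem_archLocal_diagonal L 3 (α' ∘ ⇑τ) v (z₁ v)⟩ : archLocal L 3 (Matrix.diagonal (α' ∘ ⇑τ)) v)} :
        Set (archLocal L 3 (Matrix.diagonal (α' ∘ ⇑τ)) v)))]
    [iRαb : ∀ (v : {w : InfinitePlace L // IsComplex w}) (τ : Perm (Fin 3)), BorelSpace (archLocal L 3 (Matrix.diagonal (α' ∘ ⇑τ)) v ⧸ Subgroup.centralizer
      ({(⟨circleDiagonal 3 (z₁ v), circleDiagonal_mem_archLocal_diagonal L 3 (α' ∘ ⇑τ) v (z₁ v)⟩ : archLocal L 3 (Matrix.diagonal (α' ∘ ⇑τ)) v)} :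
        Set (archLocal L 3 (Matrix.diagonal (α' ∘ ⇑τ)) v)))]
    (νH : ∀ (v : {w : InfinitePlace L // IsComplex w}) (τ : Perm (Fin 3)), Measure (Subgroup.centralizer
      ({(⟨circleDiagonal 3 (z₁ v), circleDiagonal_mem_archLocal_diagonal L 3 (α' ∘ ⇑τ) v (z₁ v)⟩ : archLocal L 3 (Matrix.diagonal (α' ∘ ⇑τ)) v)} :
        Set (archLocal L 3 (Matrix.diagonal (α' ∘ ⇑τ)) v))))
    (hνH : ∀ v τ, (νH v τ).IsHaarMeasure ∧ (νH v τ).IsInvInvariant)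
    (ντ : ∀ (v : {w : InfinitePlace L // IsComplex w}) (τ : Perm (Fin 3)), Measure (archLocal L 3 (Matrix.diagonal (α' ∘ ⇑τ)) v))
    (hντi : ∀ v τ, (ντ v τ).IsHaarMeasure ∧ (ντ v τ).IsMulRightInvariant)
    (hντ : ντ = fun v τ => (νw v).map (ContinuousMulEquiv.restrictSubgroup (GLn.conjEquiv (Matrix.GeneralLinearGroup.mkOfDetNeZero _ (det_monomial_one_ne_zero 3 τ)))
              (archLocal L 3 (Matrix.diagonal (α' ∘ ⇑τ)) v) (archLocal L 3 (Matrix.diagonal α') v)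
              (mem_archLocal_comp_perm_iff_conj_mem L 3 α' v τ)).symm)
    (c : {w : InfinitePlace L // IsComplex w} → Perm (Fin 3) → ℂ)
    (hcl : ∀ (v : {w : InfinitePlace L // IsComplex w}), ∀ (τ : Perm (Fin 3)), (v.1.embedding (α' (τ 0))).re * (v.1.embedding (α' (τ 2))).re < 0 →
      haveI : LocallyCompactSpace (archLocal L 3 (Matrix.diagonal (α' ∘ ⇑τ)) v) := locallyCompactSpace_archLocal L 3 (Matrix.diagonal (α' ∘ ⇑τ)) v
      haveI : SecondCountableTopology (archLocal L 3 (Matrix.diagonal (α' ∘ ⇑τ)) v) := secondCountableTopology_archLocal L 3 (Matrix.diagonal (α' ∘ ⇑τ)) v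
      haveI : (νH v τ).IsHaarMeasure := (hνH v τ).1
      haveI : (νH v τ).IsInvInvariant := (hνH v τ).2
      haveI : (ντ v τ).IsHaarMeasure := (hντi v τ).1
      haveI : (ντ v τ).IsMulRightInvariant := (hντi v τ).2
      ∀ (Θ : Matrix (Fin 3) (Fin 3) ℂ → ℂ), ContDiff ℝ (⊤ : ℕ∞) Θ →
        HasCompactSupport (fun k : archLocal L 3 (Matrix.diagonal (α' ∘ ⇑τ)) v => Θ ((k : GL (Fin 3) ℂ) : Matrix (Fin 3) (Fin 3) ℂ)) →
        ∀ (z₀ : Fin 3 → Circle) (h02' : z₀ 0 = z₀ 2) (h01' : z₀ 0 ≠ z₀ 1),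
          Tendsto (fun ψ : ℝ => deriv (fun ψ : ℝ => (2 * Real.sin ψ : ℂ) *
              ∫ g, Θ (((g * ⟨circleDiagonal 3 (fun i => z₀ i * Circle.exp (![(1 : ℝ), 0, -1] i * ψ)),
                circleDiagonal_mem_archLocal_diagonal L 3 (α' ∘ ⇑τ) v _⟩ * g⁻¹ : archLocal L 3 (Matrix.diagonal (α' ∘ ⇑τ)) v) : GL (Fin 3) ℂ) : Matrix (Fin 3) (Fin 3) ℂ)
                ∂(ντ v τ)) ψ)
            (𝓝[≠] 0)
            (𝓝 (c v τ * ∫ y, descConj (⟨circleDiagonal 3 z₀, circleDiagonal_mem_archLocal_diagonal L 3 (α' ∘ ⇑τ) v z₀⟩ : archLocal L 3 (Matrix.diagonal (α' ∘ ⇑τ)) v)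
              (Subgroup.centralizer ({(⟨circleDiagonal 3 (z₁ v), circleDiagonal_mem_archLocal_diagonal L 3 (α' ∘ ⇑τ) v (z₁ v)⟩ : archLocal L 3 (Matrix.diagonal (α' ∘ ⇑τ)) v)} :
                Set (archLocal L 3 (Matrix.diagonal (α' ∘ ⇑τ)) v)))
              (forall_mem_centralizer_circleDiagonal_comm_of_wall L (α' ∘ ⇑τ) v (h02 v) (h01 v) h02' h01')
              (fun k : archLocal L 3 (Matrix.diagonal (α' ∘ ⇑τ)) v => Θ ((k : GL (Fin 3) ℂ) : Matrix (Fin 3) (Fin 3) ℂ)) y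
              ∂(quotientMeasure _ (νH v τ) (isClosed_coe_centralizer_singleton _)
                (ντ v τ)))))
    (hcneg : ∀ (v : {w : InfinitePlace L // IsComplex w}) (σ : Perm (Fin 3)),
      ¬ 0 < (v.1.embedding (α' (σ⁻¹ 0))).re * (v.1.embedding (α' (σ⁻¹ 2))).re → c v σ⁻¹ = -1)
    [iRβ : ∀ (v : {w : InfinitePlace L // IsComplex w}) (τ : Perm (Fin 3)), MeasurableSpace (archLocal L 3 (Matrix.diagonal (β ∘ ⇑τ)) v ⧸ Subgroup.centralizer
      ({(⟨circleDiagonal 3 (z₁ v), circleDiagonal_mem_archLocal_diagonal L 3 (β ∘ ⇑τ) v (z₁ v)⟩ : archLocal L 3 (Matrix.diagonal (β ∘ ⇑τ)) v)} :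
        Set (archLocal L 3 (Matrix.diagonal (β ∘ ⇑τ)) v)))]
    [iRβb : ∀ (v : {w : InfinitePlace L // IsComplex w}) (τ : Perm (Fin 3)), BorelSpace (archLocal L 3 (Matrix.diagonal (β ∘ ⇑τ)) v ⧸ Subgroup.centralizer
      ({(⟨circleDiagonal 3 (z₁ v), circleDiagonal_mem_archLocal_diagonal L 3 (β ∘ ⇑τ) v (z₁ v)⟩ : archLocal L 3 (Matrix.diagonal (β ∘ ⇑τ)) v)} :
        Set (archLocal L 3 (Matrix.diagonal (β ∘ ⇑τ)) v)))]
    (νH' : ∀ (v : {w : InfinitePlace L // IsComplex w}) (τ : Perm (Fin 3)), Measure (Subgroup.centralizer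
      ({(⟨circleDiagonal 3 (z₁ v), circleDiagonal_mem_archLocal_diagonal L 3 (β ∘ ⇑τ) v (z₁ v)⟩ : archLocal L 3 (Matrix.diagonal (β ∘ ⇑τ)) v)} :
        Set (archLocal L 3 (Matrix.diagonal (β ∘ ⇑τ)) v))))
    (hνH' : ∀ v τ, (νH' v τ).IsHaarMeasure ∧ (νH' v τ).IsInvInvariant)
    (ντ' : ∀ (v : {w : InfinitePlace L // IsComplex w}) (τ : Perm (Fin 3)), Measure (archLocal L 3 (Matrix.diagonal (β ∘ ⇑τ)) v))
    (hντi' : ∀ v τ, (ντ' v τ).IsHaarMeasure ∧ (ντ' v τ).IsMulRightInvariant)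
    (hντ' : ντ' = fun v τ => (νw' v).map (ContinuousMulEquiv.restrictSubgroup (GLn.conjEquiv (Matrix.GeneralLinearGroup.mkOfDetNeZero _ (det_monomial_one_ne_zero 3 τ)))
              (archLocal L 3 (Matrix.diagonal (β ∘ ⇑τ)) v) (archLocal L 3 (Matrix.diagonal β) v)
              (mem_archLocal_comp_perm_iff_conj_mem L 3 β v τ)).symm)
    (c' : {w : InfinitePlace L // IsComplex w} → Perm (Fin 3) → ℂ)
    (hcl' : ∀ (v : {w : InfinitePlace L // IsComplex w}), ∀ (τ : Perm (Fin 3)), (v.1.embedding (β (τ 0))).re * (v.1.embedding (β (τ 2))).re < 0 →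
      haveI : LocallyCompactSpace (archLocal L 3 (Matrix.diagonal (β ∘ ⇑τ)) v) := locallyCompactSpace_archLocal L 3 (Matrix.diagonal (β ∘ ⇑τ)) v
      haveI : SecondCountableTopology (archLocal L 3 (Matrix.diagonal (β ∘ ⇑τ)) v) := secondCountableTopology_archLocal L 3 (Matrix.diagonal (β ∘ ⇑τ)) v
      haveI : (νH' v τ).IsHaarMeasure := (hνH' v τ).1
      haveI : (νH' v τ).IsInvInvariant := (hνH' v τ).2
      haveI : (ντ' v τ).IsHaarMeasure := (hντi' v τ).1
      haveI : (ντ' v τ).IsMulRightInvariant := (hντi' v τ).2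
      ∀ (Θ' : Matrix (Fin 3) (Fin 3) ℂ → ℂ), ContDiff ℝ (⊤ : ℕ∞) Θ' →
        HasCompactSupport (fun k : archLocal L 3 (Matrix.diagonal (β ∘ ⇑τ)) v => Θ' ((k : GL (Fin 3) ℂ) : Matrix (Fin 3) (Fin 3) ℂ)) →
        ∀ (z₀ : Fin 3 → Circle) (h02' : z₀ 0 = z₀ 2) (h01' : z₀ 0 ≠ z₀ 1),
          Tendsto (fun ψ : ℝ => deriv (fun ψ : ℝ => (2 * Real.sin ψ : ℂ) *
              ∫ g, Θ' (((g * ⟨circleDiagonal 3 (fun i => z₀ i * Circle.exp (![(1 : ℝ), 0, -1] i * ψ)),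
                circleDiagonal_mem_archLocal_diagonal L 3 (β ∘ ⇑τ) v _⟩ * g⁻¹ : archLocal L 3 (Matrix.diagonal (β ∘ ⇑τ)) v) : GL (Fin 3) ℂ) : Matrix (Fin 3) (Fin 3) ℂ)
                ∂(ντ' v τ)) ψ)
            (𝓝[≠] 0)
            (𝓝 (c' v τ * ∫ y, descConj (⟨circleDiagonal 3 z₀, circleDiagonal_mem_archLocal_diagonal L 3 (β ∘ ⇑τ) v z₀⟩ : archLocal L 3 (Matrix.diagonal (β ∘ ⇑τ)) v)
              (Subgroup.centralizer ({(⟨circleDiagonal 3 (z₁ v), circleDiagonal_mem_archLocal_diagonal L 3 (β ∘ ⇑τ) v (z₁ v)⟩ : archLocal L 3 (Matrix.diagonal (β ∘ ⇑τ)) v)} :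
                Set (archLocal L 3 (Matrix.diagonal (β ∘ ⇑τ)) v)))
              (forall_mem_centralizer_circleDiagonal_comm_of_wall L (β ∘ ⇑τ) v (h02 v) (h01 v) h02' h01')
              (fun k : archLocal L 3 (Matrix.diagonal (β ∘ ⇑τ)) v => Θ' ((k : GL (Fin 3) ℂ) : Matrix (Fin 3) (Fin 3) ℂ)) y
              ∂(quotientMeasure _ (νH' v τ) (isClosed_coe_centralizer_singleton _)
                (ντ' v τ)))))
    (hcneg' : ∀ (v : {w : InfinitePlace L // IsComplex w}) (σ : Perm (Fin 3)),
      ¬ 0 < (v.1.embedding (β (σ⁻¹ 0))).re * (v.1.embedding (β (σ⁻¹ 2))).re → c' v σ⁻¹ = -1)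
    -- ===== the SINGULAR families and their pinned Weil form at every wall torus point of the diagonal carriers =====
    (ms' : OrbitalMeasureFamily (arch (↥(maximalRealSubfield L)) L (IsCMField.complexConj L) 3 H'))
    (hinv' : ∀ q : ConjClasses (arch (↥(maximalRealSubfield L)) L (IsCMField.complexConj L) 3 H'), SMulInvariantMeasure (arch (↥(maximalRealSubfield L)) L (IsCMField.complexConj L) 3 H') (arch (↥(maximalRealSubfield L)) L (IsCMField.complexConj L) 3 H' ⧸ Subgroup.centralizer ({(Quotient.out q : arch (↥(maximalRealSubfield L)) L (IsCMField.complexConj L) 3 H')} : Set _)) (ms' q))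
    (ms : OrbitalMeasureFamily (arch (↥(maximalRealSubfield L)) L (IsCMField.complexConj L) 3 (Matrix.of fun i j : Fin 3 => if i.val + j.val + 1 = 3 then (1 : L) else 0)))
    (hinv : ∀ q : ConjClasses (arch (↥(maximalRealSubfield L)) L (IsCMField.complexConj L) 3 (Matrix.of fun i j : Fin 3 => if i.val + j.val + 1 = 3 then (1 : L) else 0)),
      SMulInvariantMeasure (arch (↥(maximalRealSubfield L)) L (IsCMField.complexConj L) 3 (Matrix.of fun i j : Fin 3 => if i.val + j.val + 1 = 3 then (1 : L) else 0)) (arch (↥(maximalRealSubfield L)) L (IsCMField.complexConj L) 3 (Matrix.of fun i j : Fin 3 => if i.val + j.val + 1 = 3 then (1 : L) else 0) ⧸ Subgroup.centralizer ({(Quotient.out q : arch (↥(maximalRealSubfield L)) L (IsCMField.complexConj L) 3 (Matrix.of fun i j : Fin 3 => if i.val + j.val + 1 = 3 then (1 : L) else 0))} : Set _)) (ms q))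
    (hpinα : ∀ (z0 : {w : InfinitePlace L // IsComplex w} → Fin 3 → Circle) (hwall : ∀ v, z0 v 0 = z0 v 2 ∧ z0 v 0 ≠ z0 v 1),
      ∃ (ρZ : ∀ (v : {w : InfinitePlace L // IsComplex w}) (σ : Perm (Fin 3)), Measure (Subgroup.centralizer
        ({(⟨circleDiagonal 3 (z0 v ∘ ⇑σ), circleDiagonal_mem_archLocal_diagonal L 3 α' v (z0 v ∘ ⇑σ)⟩ : archLocal L 3 (Matrix.diagonal α') v)} : Set (archLocal L 3 (Matrix.diagonal α') v))))
        (_ : ∀ v σ, (ρZ v σ).IsHaarMeasure ∧ (ρZ v σ).IsInvInvariant)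
        (ρP : ∀ ρ : {w : InfinitePlace L // IsComplex w} → Perm (Fin 3), Measure (Subgroup.pi Set.univ (fun w : {w : InfinitePlace L // IsComplex w} => Subgroup.centralizer
        ({(⟨circleDiagonal 3 (z0 w ∘ ⇑(ρ w)), circleDiagonal_mem_archLocal_diagonal L 3 α' w (z0 w ∘ ⇑(ρ w))⟩ : archLocal L 3 (Matrix.diagonal α') w)} : Set _))))
        (_ : ∀ ρ, (ρP ρ).IsHaarMeasure ∧ (ρP ρ).IsInvInvariant)
        (ρ' : ∀ ρ : {w : InfinitePlace L // IsComplex w} → Perm (Fin 3),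
        Measure (Subgroup.centralizer ({archDiagTorus L 3 α' fun w => z0 w ∘ ⇑(ρ w)} : Set (arch (↥(maximalRealSubfield L)) L (IsCMField.complexConj L) 3 (Matrix.diagonal α')))))
        (hρ'i : ∀ ρ, (ρ' ρ).IsHaarMeasure ∧ (ρ' ρ).IsInvInvariant),
        (∀ (v : {w : InfinitePlace L // IsComplex w}) (σ : Perm (Fin 3)), ¬ 0 < (v.1.embedding (α' (σ⁻¹ 0))).re * (v.1.embedding (α' (σ⁻¹ 2))).re →
        ρZ v σ = (νH v σ⁻¹).map (subgroupCongrHomeomorph (ContinuousMulEquiv.restrictSubgroup (GLn.conjEquiv (Matrix.GeneralLinearGroup.mkOfDetNeZero _ (det_monomial_one_ne_zero 3 σ⁻¹)))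
          (archLocal L 3 (Matrix.diagonal (α' ∘ ⇑σ⁻¹)) v) (archLocal L 3 (Matrix.diagonal α') v) (mem_archLocal_comp_perm_iff_conj_mem L 3 α' v σ⁻¹)).toMulEquiv
          (Subgroup.centralizer ({(⟨circleDiagonal 3 (z₁ v), circleDiagonal_mem_archLocal_diagonal L 3 (α' ∘ ⇑σ⁻¹) v (z₁ v)⟩ : archLocal L 3 (Matrix.diagonal (α' ∘ ⇑σ⁻¹)) v)} : Set (archLocal L 3 (Matrix.diagonal (α' ∘ ⇑σ⁻¹)) v)))
          (Subgroup.centralizer ({(⟨circleDiagonal 3 (z0 v ∘ ⇑σ), circleDiagonal_mem_archLocal_diagonal L 3 α' v (z0 v ∘ ⇑σ)⟩ : archLocal L 3 (Matrix.diagonal α') v)} : Set (archLocal L 3 (Matrix.diagonal α') v)))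
          (relabel_inv_mem_centralizer_circleDiagonal_comp_iff L α' v σ (h02 v) (h01 v) (hwall v).1 (hwall v).2)
          (ContinuousMulEquiv.restrictSubgroup (GLn.conjEquiv (Matrix.GeneralLinearGroup.mkOfDetNeZero _ (det_monomial_one_ne_zero 3 σ⁻¹)))
            (archLocal L 3 (Matrix.diagonal (α' ∘ ⇑σ⁻¹)) v) (archLocal L 3 (Matrix.diagonal α') v) (mem_archLocal_comp_perm_iff_conj_mem L 3 α' v σ⁻¹)).continuous
          (ContinuousMulEquiv.restrictSubgroup (GLn.conjEquiv (Matrix.GeneralLinearGroup.mkOfDetNeZero _ (det_monomial_one_ne_zero 3 σ⁻¹)))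
            (archLocal L 3 (Matrix.diagonal (α' ∘ ⇑σ⁻¹)) v) (archLocal L 3 (Matrix.diagonal α') v) (mem_archLocal_comp_perm_iff_conj_mem L 3 α' v σ⁻¹)).symm.continuous)) ∧
        (∀ (v : {w : InfinitePlace L // IsComplex w}) (σ : Perm (Fin 3)),
        0 < (v.1.embedding (α' (σ⁻¹ 0))).re * (v.1.embedding (α' (σ⁻¹ 2))).re → ((ρZ v σ) Set.univ).toReal = 1) ∧
        (∀ ρ : {w : InfinitePlace L // IsComplex w} → Perm (Fin 3), Measure.map (subgroupPiCoords fun w : {w : InfinitePlace L // IsComplex w} => Subgroup.centralizer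
        ({(⟨circleDiagonal 3 (z0 w ∘ ⇑(ρ w)), circleDiagonal_mem_archLocal_diagonal L 3 α' w (z0 w ∘ ⇑(ρ w))⟩ : archLocal L 3 (Matrix.diagonal α') w)} : Set _)) (ρP ρ) =
          Measure.pi fun w => ρZ w (ρ w)) ∧
        (∀ ρ : {w : InfinitePlace L // IsComplex w} → Perm (Fin 3), ρ' ρ = (ρP ρ).map (subgroupCongrHomeomorph (archPiEquivCM 3 L (Matrix.diagonal α')).symm.toMulEquiv
        (Subgroup.pi Set.univ (fun w : {w : InfinitePlace L // IsComplex w} => Subgroup.centralizer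
          ({(⟨circleDiagonal 3 (z0 w ∘ ⇑(ρ w)), circleDiagonal_mem_archLocal_diagonal L 3 α' w (z0 w ∘ ⇑(ρ w))⟩ : archLocal L 3 (Matrix.diagonal α') w)} : Set _)))
        (Subgroup.centralizer ({archDiagTorus L 3 α' fun w => z0 w ∘ ⇑(ρ w)} : Set _))
        (apply_mem_centralizer_iff_mem_pi_centralizer _ (archPiEquivCM 3 L (Matrix.diagonal α')).symm.toMulEquiv
          (archPiEquivCM_symm_circleDiagonal_eq_archDiagTorus L 3 α' fun w => z0 w ∘ ⇑(ρ w)))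
        (archPiEquivCM 3 L (Matrix.diagonal α')).symm.continuous (archPiEquivCM 3 L (Matrix.diagonal α')).continuous)) ∧
        (∀ ρ : {w : InfinitePlace L // IsComplex w} → Perm (Fin 3),
        haveI : ∀ w : {w : InfinitePlace L // IsComplex w}, LocallyCompactSpace (archLocal L 3 (Matrix.diagonal α') w) := fun w => locallyCompactSpace_archLocal L 3 (Matrix.diagonal α') w
        haveI : ∀ w : {w : InfinitePlace L // IsComplex w}, SecondCountableTopology (archLocal L 3 (Matrix.diagonal α') w) := fun w => secondCountableTopology_archLocal L 3 (Matrix.diagonal α') w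
        haveI : (ρ' ρ).IsHaarMeasure := (hρ'i ρ).1
        haveI : (ρ' ρ).IsInvInvariant := (hρ'i ρ).2
        haveI : ∀ w : {w : InfinitePlace L // IsComplex w}, (νw w).IsHaarMeasure := fun w => (hνw w).1
        haveI : ((Measure.pi νw).map (archPiEquivCM 3 L (Matrix.diagonal α')).symm).IsHaarMeasure := isHaarMeasure_map_archPiEquivCM_symm_pi L 3 α' νw
        haveI : ((Measure.pi νw).map (archPiEquivCM 3 L (Matrix.diagonal α')).symm).IsMulRightInvariant := hν' ▸ isMulRightInvariant_map_continuousMulEquiv Ψ ν'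
        (ms'.transport Ψ.toMulEquiv Ψ.continuous Ψ.symm.continuous).atPoint (archDiagTorus L 3 α' fun w => z0 w ∘ ⇑(ρ w)) =
          quotientMeasure (Subgroup.centralizer ({archDiagTorus L 3 α' fun w => z0 w ∘ ⇑(ρ w)} : Set _)) (ρ' ρ) (isClosed_coe_centralizer_singleton _)
            ((Measure.pi νw).map (archPiEquivCM 3 L (Matrix.diagonal α')).symm)))
    (hpinβ : ∀ (z0 : {w : InfinitePlace L // IsComplex w} → Fin 3 → Circle) (hwall : ∀ v, z0 v 0 = z0 v 2 ∧ z0 v 0 ≠ z0 v 1),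
      ∃ (ρZ' : ∀ (v : {w : InfinitePlace L // IsComplex w}) (σ : Perm (Fin 3)), Measure (Subgroup.centralizer
        ({(⟨circleDiagonal 3 (z0 v ∘ ⇑σ), circleDiagonal_mem_archLocal_diagonal L 3 β v (z0 v ∘ ⇑σ)⟩ : archLocal L 3 (Matrix.diagonal β) v)} : Set (archLocal L 3 (Matrix.diagonal β) v))))
        (_ : ∀ v σ, (ρZ' v σ).IsHaarMeasure ∧ (ρZ' v σ).IsInvInvariant)
        (ρP' : ∀ ρ : {w : InfinitePlace L // IsComplex w} → Perm (Fin 3), Measure (Subgroup.pi Set.univ (fun w : {w : InfinitePlace L // IsComplex w} => Subgroup.centralizer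
        ({(⟨circleDiagonal 3 (z0 w ∘ ⇑(ρ w)), circleDiagonal_mem_archLocal_diagonal L 3 β w (z0 w ∘ ⇑(ρ w))⟩ : archLocal L 3 (Matrix.diagonal β) w)} : Set _))))
        (_ : ∀ ρ, (ρP' ρ).IsHaarMeasure ∧ (ρP' ρ).IsInvInvariant)
        (ρ'' : ∀ ρ : {w : InfinitePlace L // IsComplex w} → Perm (Fin 3),
        Measure (Subgroup.centralizer ({archDiagTorus L 3 β fun w => z0 w ∘ ⇑(ρ w)} : Set (arch (↥(maximalRealSubfield L)) L (IsCMField.complexConj L) 3 (Matrix.diagonal β)))))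
        (hρ''i : ∀ ρ, (ρ'' ρ).IsHaarMeasure ∧ (ρ'' ρ).IsInvInvariant),
        (∀ (v : {w : InfinitePlace L // IsComplex w}) (σ : Perm (Fin 3)), ¬ 0 < (v.1.embedding (β (σ⁻¹ 0))).re * (v.1.embedding (β (σ⁻¹ 2))).re →
        ρZ' v σ = (νH' v σ⁻¹).map (subgroupCongrHomeomorph (ContinuousMulEquiv.restrictSubgroup (GLn.conjEquiv (Matrix.GeneralLinearGroup.mkOfDetNeZero _ (det_monomial_one_ne_zero 3 σ⁻¹)))
          (archLocal L 3 (Matrix.diagonal (β ∘ ⇑σ⁻¹)) v) (archLocal L 3 (Matrix.diagonal β) v) (mem_archLocal_comp_perm_iff_conj_mem L 3 β v σ⁻¹)).toMulEquiv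
          (Subgroup.centralizer ({(⟨circleDiagonal 3 (z₁ v), circleDiagonal_mem_archLocal_diagonal L 3 (β ∘ ⇑σ⁻¹) v (z₁ v)⟩ : archLocal L 3 (Matrix.diagonal (β ∘ ⇑σ⁻¹)) v)} : Set (archLocal L 3 (Matrix.diagonal (β ∘ ⇑σ⁻¹)) v)))
          (Subgroup.centralizer ({(⟨circleDiagonal 3 (z0 v ∘ ⇑σ), circleDiagonal_mem_archLocal_diagonal L 3 β v (z0 v ∘ ⇑σ)⟩ : archLocal L 3 (Matrix.diagonal β) v)} : Set (archLocal L 3 (Matrix.diagonal β) v)))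
          (relabel_inv_mem_centralizer_circleDiagonal_comp_iff L β v σ (h02 v) (h01 v) (hwall v).1 (hwall v).2)
          (ContinuousMulEquiv.restrictSubgroup (GLn.conjEquiv (Matrix.GeneralLinearGroup.mkOfDetNeZero _ (det_monomial_one_ne_zero 3 σ⁻¹)))
            (archLocal L 3 (Matrix.diagonal (β ∘ ⇑σ⁻¹)) v) (archLocal L 3 (Matrix.diagonal β) v) (mem_archLocal_comp_perm_iff_conj_mem L 3 β v σ⁻¹)).continuous
          (ContinuousMulEquiv.restrictSubgroup (GLn.conjEquiv (Matrix.GeneralLinearGroup.mkOfDetNeZero _ (det_monomial_one_ne_zero 3 σ⁻¹)))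
            (archLocal L 3 (Matrix.diagonal (β ∘ ⇑σ⁻¹)) v) (archLocal L 3 (Matrix.diagonal β) v) (mem_archLocal_comp_perm_iff_conj_mem L 3 β v σ⁻¹)).symm.continuous)) ∧
        (∀ (v : {w : InfinitePlace L // IsComplex w}) (σ : Perm (Fin 3)),
        0 < (v.1.embedding (β (σ⁻¹ 0))).re * (v.1.embedding (β (σ⁻¹ 2))).re → ((ρZ' v σ) Set.univ).toReal = 1) ∧
        (∀ ρ : {w : InfinitePlace L // IsComplex w} → Perm (Fin 3), Measure.map (subgroupPiCoords fun w : {w : InfinitePlace L // IsComplex w} => Subgroup.centralizer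
        ({(⟨circleDiagonal 3 (z0 w ∘ ⇑(ρ w)), circleDiagonal_mem_archLocal_diagonal L 3 β w (z0 w ∘ ⇑(ρ w))⟩ : archLocal L 3 (Matrix.diagonal β) w)} : Set _)) (ρP' ρ) =
          Measure.pi fun w => ρZ' w (ρ w)) ∧
        (∀ ρ : {w : InfinitePlace L // IsComplex w} → Perm (Fin 3), ρ'' ρ = (ρP' ρ).map (subgroupCongrHomeomorph (archPiEquivCM 3 L (Matrix.diagonal β)).symm.toMulEquiv
        (Subgroup.pi Set.univ (fun w : {w : InfinitePlace L // IsComplex w} => Subgroup.centralizer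
          ({(⟨circleDiagonal 3 (z0 w ∘ ⇑(ρ w)), circleDiagonal_mem_archLocal_diagonal L 3 β w (z0 w ∘ ⇑(ρ w))⟩ : archLocal L 3 (Matrix.diagonal β) w)} : Set _)))
        (Subgroup.centralizer ({archDiagTorus L 3 β fun w => z0 w ∘ ⇑(ρ w)} : Set _))
        (apply_mem_centralizer_iff_mem_pi_centralizer _ (archPiEquivCM 3 L (Matrix.diagonal β)).symm.toMulEquiv
          (archPiEquivCM_symm_circleDiagonal_eq_archDiagTorus L 3 β fun w => z0 w ∘ ⇑(ρ w)))
        (archPiEquivCM 3 L (Matrix.diagonal β)).symm.continuous (archPiEquivCM 3 L (Matrix.diagonal β)).continuous)) ∧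
        (∀ ρ : {w : InfinitePlace L // IsComplex w} → Perm (Fin 3),
        haveI : ∀ w : {w : InfinitePlace L // IsComplex w}, LocallyCompactSpace (archLocal L 3 (Matrix.diagonal β) w) := fun w => locallyCompactSpace_archLocal L 3 (Matrix.diagonal β) w
        haveI : ∀ w : {w : InfinitePlace L // IsComplex w}, SecondCountableTopology (archLocal L 3 (Matrix.diagonal β) w) := fun w => secondCountableTopology_archLocal L 3 (Matrix.diagonal β) w
        haveI : (ρ'' ρ).IsHaarMeasure := (hρ''i ρ).1
        haveI : (ρ'' ρ).IsInvInvariant := (hρ''i ρ).2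
        haveI : ∀ w : {w : InfinitePlace L // IsComplex w}, (νw' w).IsHaarMeasure := fun w => (hνw' w).1
        haveI : ((Measure.pi νw').map (archPiEquivCM 3 L (Matrix.diagonal β)).symm).IsHaarMeasure := isHaarMeasure_map_archPiEquivCM_symm_pi L 3 β νw'
        haveI : ((Measure.pi νw').map (archPiEquivCM 3 L (Matrix.diagonal β)).symm).IsMulRightInvariant := hν ▸ isMulRightInvariant_map_continuousMulEquiv Φ_A ν
        (ms.transport Φ_A.toMulEquiv Φ_A.continuous Φ_A.symm.continuous).atPoint (archDiagTorus L 3 β fun w => z0 w ∘ ⇑(ρ w)) =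
          quotientMeasure (Subgroup.centralizer ({archDiagTorus L 3 β fun w => z0 w ∘ ⇑(ρ w)} : Set _)) (ρ'' ρ) (isClosed_coe_centralizer_singleton _)
            ((Measure.pi νw').map (archPiEquivCM 3 L (Matrix.diagonal β)).symm)))
    -- ===== the (ST-∞-s) prefix, token for token =====
    (a' : arch (↥(maximalRealSubfield L)) L (IsCMField.complexConj L) 3 H' → ℂ) (a : arch (↥(maximalRealSubfield L)) L (IsCMField.complexConj L) 3 (Matrix.of fun i j : Fin 3 => if i.val + j.val + 1 = 3 then (1 : L) else 0) → ℂ)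
    (hsm' : ArchSmooth L 3 H' a') (hsm : ArchSmooth L 3 (Matrix.of fun i j : Fin 3 => if i.val + j.val + 1 = 3 then (1 : L) else 0) a) (hit : IsArchInnerTransfer L H' m' m a' a)
    (γ₀ : (cmDatum L 3 H').Rational) (γ : (cmDatum L 3 (Matrix.of fun i j : Fin 3 => if i.val + j.val + 1 = 3 then (1 : L) else 0)).Rational) (e₁ e₂ : L)
    (hcorr : Corresponds (cmConjRingHom L) H' (Matrix.of fun i j : Fin 3 => if i.val + j.val + 1 = 3 then (1 : L) else 0) (γ₀ : unitaryGroup (cmConjRingHom L) H') (γ : unitaryGroup (cmConjRingHom L) (Matrix.of fun i j : Fin 3 => if i.val + j.val + 1 = 3 then (1 : L) else 0)))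
    (he : e₁ ≠ e₂)
    (hsplit : ((((γ₀ : unitaryGroup (cmConjRingHom L) H').val : GL (Fin 3) L) : Matrix (Fin 3) (Fin 3) L) - e₁ • (1 : Matrix (Fin 3) (Fin 3) L)) *
      ((((γ₀ : unitaryGroup (cmConjRingHom L) H').val : GL (Fin 3) L) : Matrix (Fin 3) (Fin 3) L) - e₂ • (1 : Matrix (Fin 3) (Fin 3) L)) = 0)
    (hnc : ¬ ∃ ζ : L, (((γ₀ : unitaryGroup (cmConjRingHom L) H').val : GL (Fin 3) L) : Matrix (Fin 3) (Fin 3) L) = ζ • (1 : Matrix (Fin 3) (Fin 3) L)) :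
    archStableOrbitalIntegral L 3 H' ms' (fun x => kottwitzSignArchWeight L 3 H' (ConjClasses.mk x) * a' x) (cmRationalToArch L 3 H' γ₀) =
      archStableOrbitalIntegral L 3 (Matrix.of fun i j : Fin 3 => if i.val + j.val + 1 = 3 then (1 : L) else 0) ms
        (fun x => kottwitzSignArchWeight L 3 (Matrix.of fun i j : Fin 3 => if i.val + j.val + 1 = 3 then (1 : L) else 0) (ConjClasses.mk x) * a x) (cmRationalToArch L 3 (Matrix.of fun i j : Fin 3 => if i.val + j.val + 1 = 3 then (1 : L) else 0) γ) := by
  classical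
  -- ★ p842577 §5: both sides on the diagonal carriers at ONE wall torus point `t(z⁰)`, `z⁰_w = (σ_w a₀, σ_w b₀, σ_w a₀)`
  obtain ⟨a₀, b₀, ha₀, hb₀, -, -, hwall₀, eL, eR⟩ :=
    exists_wall_archStableOrbitalIntegral_signed_eq_archDiagTorus_of_corresponds L H' α' S Ψ hΨ hS β T_A Φ_A hΦ_A hT_A hherm hanis γ₀ he hsplit hnc γ hcorr ms' a' ms a
  -- ambient lifts of the transported functions (★ FILE 4 + ★ `ArchSmooth.exists_contDiff`)
  obtain ⟨Θ, hΘ, -, hΘc, hΘa⟩ := (ArchSmooth.comp_archCongr_symm L S Ψ hΨ hsm').exists_contDiff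
  obtain ⟨Θ', hΘ', -, hΘ'c, hΘ'a⟩ := (ArchSmooth.comp_archCongr_symm L T_A Φ_A hΦ_A hsm).exists_contDiff
  have hfa : (fun x : arch (↥(maximalRealSubfield L)) L (IsCMField.complexConj L) 3 (Matrix.diagonal α') => kottwitzSignArchWeight L 3 (Matrix.diagonal α') (ConjClasses.mk x) * (a' ∘ Ψ.symm) x) =
      fun x => kottwitzSignArchWeight L 3 (Matrix.diagonal α') (ConjClasses.mk x) * Θ ((x : GL (Fin 3) (mixedSpace L)) : Matrix (Fin 3) (Fin 3) (mixedSpace L)) :=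
    funext fun x => by rw [hΘa x]
  have hfb : (fun x : arch (↥(maximalRealSubfield L)) L (IsCMField.complexConj L) 3 (Matrix.diagonal β) => kottwitzSignArchWeight L 3 (Matrix.diagonal β) (ConjClasses.mk x) * (a ∘ Φ_A.symm) x) =
      fun x => kottwitzSignArchWeight L 3 (Matrix.diagonal β) (ConjClasses.mk x) * Θ' ((x : GL (Fin 3) (mixedSpace L)) : Matrix (Fin 3) (Fin 3) (mixedSpace L)) :=
    funext fun x => by rw [hΘ'a x]
  -- ★ p842954: (14.2.1) for the Weil-form regular families ⇒ ★ p842366's `hreg`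
  have haΘ : ∀ x, a' x = Θ (((Ψ x : arch (↥(maximalRealSubfield L)) L (IsCMField.complexConj L) 3 (Matrix.diagonal α')) : GL (Fin 3) (mixedSpace L)) : Matrix (Fin 3) (Fin 3) (mixedSpace L)) := fun x => by
    rw [← hΘa (Ψ x), Function.comp_apply, ContinuousMulEquiv.symm_apply_apply]
  have haΘ' : ∀ x, a x = Θ' (((Φ_A x : arch (↥(maximalRealSubfield L)) L (IsCMField.complexConj L) 3 (Matrix.diagonal β)) : GL (Fin 3) (mixedSpace L)) : Matrix (Fin 3) (Fin 3) (mixedSpace L)) := fun x => by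
    rw [← hΘ'a (Φ_A x), Function.comp_apply, ContinuousMulEquiv.symm_apply_apply]
  have hreg := fun (z : {w : InfinitePlace L // IsComplex w} → Fin 3 → Circle) (hz : ∀ v, Function.Injective (z v)) =>
    sum_inv_mul_integral_pi_map_conj_eq_of_isArchInnerTransfer L H' t' t hd' hd₃ hC hC'G ν' ν m' m hW' hW a' a
      hsm'.continuous.measurable hsm.continuous.measurable hit α' β hα' hhermα hβ hhermβ S Ψ hΨ T_A Φ_A hΦ_A νw (fun v => (hνw v).1) hν' νw' (fun v => (hνw' v).1) hν
      Θ Θ' hΘ.continuous hΘ'.continuous haΘ haΘ' z hz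
  -- the instances ★ p842366 binds (each carrier's `∀`-instances SCOPED to its own term: two carriers' `∀ w`-instances in one context make
  -- typeclass search unify `archLocal … α′ w` with `archLocal … β w` by unfolding — ★ p841776's two-carrier elaboration rule)
  have iHα : ((Measure.pi νw).map (archPiEquivCM 3 L (Matrix.diagonal α')).symm).IsHaarMeasure :=
    haveI : ∀ w : {w : InfinitePlace L // IsComplex w}, (νw w).IsHaarMeasure := fun w => (hνw w).1
    haveI : ∀ w : {w : InfinitePlace L // IsComplex w}, LocallyCompactSpace (archLocal L 3 (Matrix.diagonal α') w) :=
      fun w => locallyCompactSpace_archLocal L 3 (Matrix.diagonal α') w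
    haveI : ∀ w : {w : InfinitePlace L // IsComplex w}, SecondCountableTopology (archLocal L 3 (Matrix.diagonal α') w) :=
      fun w => secondCountableTopology_archLocal L 3 (Matrix.diagonal α') w
    isHaarMeasure_map_archPiEquivCM_symm_pi L 3 α' νw
  have iHαr : ((Measure.pi νw).map (archPiEquivCM 3 L (Matrix.diagonal α')).symm).IsMulRightInvariant := hν' ▸ isMulRightInvariant_map_continuousMulEquiv Ψ ν'
  have iHβ : ((Measure.pi νw').map (archPiEquivCM 3 L (Matrix.diagonal β)).symm).IsHaarMeasure :=
    haveI : ∀ w : {w : InfinitePlace L // IsComplex w}, (νw' w).IsHaarMeasure := fun w => (hνw' w).1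
    haveI : ∀ w : {w : InfinitePlace L // IsComplex w}, LocallyCompactSpace (archLocal L 3 (Matrix.diagonal β) w) :=
      fun w => locallyCompactSpace_archLocal L 3 (Matrix.diagonal β) w
    haveI : ∀ w : {w : InfinitePlace L // IsComplex w}, SecondCountableTopology (archLocal L 3 (Matrix.diagonal β) w) :=
      fun w => secondCountableTopology_archLocal L 3 (Matrix.diagonal β) w
    isHaarMeasure_map_archPiEquivCM_symm_pi L 3 β νw'
  have iHβr : ((Measure.pi νw').map (archPiEquivCM 3 L (Matrix.diagonal β)).symm).IsMulRightInvariant := hν ▸ isMulRightInvariant_map_continuousMulEquiv Φ_A ν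
  have iSα := fun q : ConjClasses (arch (↥(maximalRealSubfield L)) L (IsCMField.complexConj L) 3 (Matrix.diagonal α')) =>
    (haveI := hinv' (preClass Ψ.toMulEquiv q)
     smulInvariantMeasure_transport Ψ.toMulEquiv Ψ.continuous Ψ.symm.continuous ms' q)
  have iSβ := fun q : ConjClasses (arch (↥(maximalRealSubfield L)) L (IsCMField.complexConj L) 3 (Matrix.diagonal β)) =>
    (haveI := hinv (preClass Φ_A.toMulEquiv q)
     smulInvariantMeasure_transport Φ_A.toMulEquiv Φ_A.continuous Φ_A.symm.continuous ms q)
  -- pin (i): all wall constants are `∓1`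
  have hC1 : ∀ (v : {w : InfinitePlace L // IsComplex w}) (σ : Perm (Fin 3)), ¬ 0 < (v.1.embedding (α' (σ⁻¹ 0))).re * (v.1.embedding (α' (σ⁻¹ 2))).re →
      c v σ⁻¹ = -((fun _ : {w : InfinitePlace L // IsComplex w} => (1 : ℝ)) v : ℂ) := fun v σ h => by rw [hcneg v σ h, Complex.ofReal_one]
  have hC1' : ∀ (v : {w : InfinitePlace L // IsComplex w}) (σ : Perm (Fin 3)), ¬ 0 < (v.1.embedding (β (σ⁻¹ 0))).re * (v.1.embedding (β (σ⁻¹ 2))).re →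
      c' v σ⁻¹ = -((fun _ : {w : InfinitePlace L // IsComplex w} => (1 : ℝ)) v : ℂ) := fun v σ h => by rw [hcneg' v σ h, Complex.ofReal_one]
  -- ★ p842366 at EVERY wall point, constants cancelled
  have main : ∀ (z0 : {w : InfinitePlace L // IsComplex w} → Fin 3 → Circle) (hwall : ∀ v, z0 v 0 = z0 v 2 ∧ z0 v 0 ≠ z0 v 1),
      archStableOrbitalIntegral L 3 (Matrix.diagonal α') (ms'.transport Ψ.toMulEquiv Ψ.continuous Ψ.symm.continuous)
          (fun x => kottwitzSignArchWeight L 3 (Matrix.diagonal α') (ConjClasses.mk x) * Θ ((x : GL (Fin 3) (mixedSpace L)) : Matrix (Fin 3) (Fin 3) (mixedSpace L)))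
          (archDiagTorus L 3 α' z0) =
        archStableOrbitalIntegral L 3 (Matrix.diagonal β) (ms.transport Φ_A.toMulEquiv Φ_A.continuous Φ_A.symm.continuous)
          (fun x => kottwitzSignArchWeight L 3 (Matrix.diagonal β) (ConjClasses.mk x) * Θ' ((x : GL (Fin 3) (mixedSpace L)) : Matrix (Fin 3) (Fin 3) (mixedSpace L)))
          (archDiagTorus L 3 β z0) := by
    intro z0 hwall
    -- the pinned singular packages at `z⁰`
    obtain ⟨ρZ, hρZi, ρP, hρPi, ρ', hρ'i, hρZ, hM, hρP, hρ', hq⟩ := hpinα z0 hwall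
    obtain ⟨ρZ', hρZ'i, ρP', hρP'i, ρ'', hρ''i, hρZ', hM', hρP', hρ'', hq'⟩ := hpinβ z0 hwall
    have key := @prod_mul_archStableOrbitalIntegral_kottwitzSign_eq_of_regular_eq_of_clause L _ _ _ α' β iGL iGLb iAα iAαb iAβ iAβb iQα iQαb iQβ iQβb iLα iLαb iLβ iLβb
      z0 hwall z₁ h02 h01 hα' hhermα νw hνw iRα iRαb νH hνH ντ hντi hντ Θ hΘ hΘc c hcl ρZ hρZi hρZ (fun _ => 1) hC1 hM (fun _ => borel _) (fun _ => @BorelSpace.mk _ _ (borel _) rfl)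
      ρP hρPi hρP iHα iHαr (ms'.transport Ψ.toMulEquiv Ψ.continuous Ψ.symm.continuous) iSα ρ' hρ'i hρ' hq
      hβ hhermβ νw' hνw' iRβ iRβb νH' hνH' ντ' hντi' hντ' Θ' hΘ' hΘ'c c' hcl' ρZ' hρZ'i hρZ' (fun _ => 1) hC1' hM' (fun _ => borel _) (fun _ => @BorelSpace.mk _ _ (borel _) rfl)
      ρP' hρP'i hρP' iHβ iHβr (ms.transport Φ_A.toMulEquiv Φ_A.continuous Φ_A.symm.continuous) iSβ ρ'' hρ''i hρ'' hq' hreg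
    have h2 : (∏ v : {w : InfinitePlace L // IsComplex w}, (-(2 : ℂ) * ((fun _ : {w : InfinitePlace L // IsComplex w} => (1 : ℝ)) v : ℝ))) ≠ 0 :=
      Finset.prod_ne_zero_iff.2 fun v _ => by norm_num
    exact mul_left_cancel₀ h2 key
  exact eL.trans (((congrArg (archStableOrbitalIntegral L 3 (Matrix.diagonal α') (ms'.transport Ψ.toMulEquiv Ψ.continuous Ψ.symm.continuous) · (archDiagTorus L 3 α' _)) hfa).trans
    ((main _ hwall₀).trans (congrArg (archStableOrbitalIntegral L 3 (Matrix.diagonal β) (ms.transport Φ_A.toMulEquiv Φ_A.continuous Φ_A.symm.continuous) · (archDiagTorus L 3 β _)) hfb).symm)).trans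
    eR.symm)

end Literature.NumberTheory.Rogawski1990

end
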